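import Literature.MathematicalPhysics.QuantumLattice.WightmanPermutedTubeDim4
import Literature.MathematicalPhysics.QuantumLattice.SpinorMapSurjective
import HarnessLib

/-!
# The symmetric continuation in four dimensions: all named facts discharged

Topic `Literature/MathematicalPhysics/QuantumLattice` (trunk T-AQFT), closing file of the
decomposition of the named fact (K) `IsWightmanQFT.extendedTube_continuation_perm_eq`
(`WightmanPermutedTube`; Osterwalder–Schrader I §5 p. 97, citing Jost (1965) p. 83: the
Bargmann–Hall–Wightman continuation `𝔚` of the `n`-point function of one scalar field satisfies
`𝔚(z ∘ σ) = 𝔚(z)` whenever `z, z ∘ σ ∈ 𝒯'ₙ`). Its four-dimensional instance (K₄)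
`IsWightmanQFT.extendedTube_continuation_perm_eq_dim4` (`WightmanPermutedTubeConnected`; the scope of
all sources) is now a **theorem**: `WightmanPermutedTubeDim4` reduced it to the normal forms (N)
of `L₊(ℂ)`, `SpinorNormalForm` reduced (N) to the surjectivity (S) of the spinor map, and
`SpinorMapSurjective` proves (S) and (N) (`ComplexLorentz.properComplexLorentz_normalForm_holds`).
This file assembles:

* `isConnected_relExtendedTube_inter_perm_holds` — Tomozawa's theorem (T) (J. Math. Phys. 4
  (1963) 1240): every `𝒯'ₙ ∩ σ𝒯'ₙ` is connected in four dimensions;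
* `permReachable_dim4` — the reachability condition of `WightmanPermutedTubeReach` at `d = 3`;
* `IsWightmanQFT.extendedTube_continuation_perm_eq_dim4_holds` — **(K₄)**;
* `IsWightmanQFT.exists_symmetric_continuation_dim4`,
  `IsWickRotationOf.schwinger_symmetric_dim4`: in four dimensions the symmetric continuation to
  the permuted extended tube, and the symmetry and real analyticity of the Schwinger functions,
  follow from the Bargmann–Hall–Wightman continuation (A)
  `IsWightmanQFT.exists_invariant_continuation` alone; with the tree's further reductions of (A)
  (`WightmanTubeInvariance`), from the spectral condition, the Fourier–Laplace representation and
  the Bargmann–Hall–Wightman theorem (`IsWickRotationOf.schwinger_symmetric_dim4_of_three_facts`).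

The general-dimension recording (K) remains a named fact: no source covers `d ≠ 3`, and for
`d = 1` the route through common real points and connected intersections fails
(`WightmanPermutedTubeConnected`, module docstring).

## Sources

* K. Osterwalder, R. Schrader, Comm. Math. Phys. 31 (1973), §5 p. 97. [OsterwalderSchraderCMP1973]
* Y. Tomozawa, J. Math. Phys. 4 (1963) 1240–1252. [Tomozawa1963]
* R. F. Streater, A. S. Wightman, *PCT, Spin and Statistics, and All That*, §1-2, §1-3, §2-4,
  Thm. 3-6. [StreaterWightman1964]
-/

noncomputable section

namespace Literature.MathematicalPhysics.QuantumLattice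

open ComplexLorentz

/-- **Tomozawa's theorem (T) holds**: in four space-time dimensions every intersection
`𝒯'ₙ ∩ σ𝒯'ₙ` of the extended tube with a permuted extended tube is connected (Tomozawa (1963),
Abstract). [cite: Tomozawa1963, Abstract] -/
theorem isConnected_relExtendedTube_inter_perm_holds : isConnected_relExtendedTube_inter_perm :=
  isConnected_relExtendedTube_inter_perm_of_normalForm_only properComplexLorentz_normalForm_holds

/-- **Reachability in four dimensions** (the geometric condition of `WightmanPermutedTubeReach`).
[folklore] -/
theorem permReachable_dim4 (n : ℕ) : PermReachable 3 n :=
  permReachable_three isConnected_relExtendedTube_inter_perm_holds n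

/-- **(K₄) holds: the holomorphic Wightman function of one scalar field is single valued on the
permuted extended tube, four space-time dimensions** (Osterwalder–Schrader I (1973), §5 p. 97;
Jost (1965) p. 83; Streater–Wightman Thm. 3-6; Tomozawa (1963)). [cite: OsterwalderSchraderCMP1973, §5 p. 97] -/
theorem IsWightmanQFT.extendedTube_continuation_perm_eq_dim4_holds {κ : Type*} :
    IsWightmanQFT.extendedTube_continuation_perm_eq_dim4 (κ := κ) :=
  IsWightmanQFT.extendedTube_continuation_perm_eq_dim4_of_normalForm_only
    properComplexLorentz_normalForm_holds

/-- **The symmetric continuation in four dimensions from the Bargmann–Hall–Wightman continuation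
(A) alone.** [folklore] -/
theorem IsWightmanQFT.exists_symmetric_continuation_dim4 {κ : Type*}
    (hA : IsWightmanQFT.exists_invariant_continuation (d := 3) (κ := κ)) :
    IsWightmanQFT.exists_symmetric_continuation (d := 3) (κ := κ) :=
  IsWightmanQFT.exists_symmetric_continuation_of_perm_eq hA
    IsWightmanQFT.extendedTube_continuation_perm_eq_dim4_holds

/-- **Symmetry and real analyticity of the Schwinger functions in four dimensions from (A)
alone.** [folklore] -/
theorem IsWickRotationOf.schwinger_symmetric_dim4 {κ : Type*}
    (hA : IsWightmanQFT.exists_invariant_continuation (d := 3) (κ := κ)) :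
    IsWickRotationOf.schwinger_symmetric (d := 3) (κ := κ) :=
  IsWickRotationOf.schwinger_symmetric_of_perm_eq hA
    IsWightmanQFT.extendedTube_continuation_perm_eq_dim4_holds

/-- **Symmetry and real analyticity of the Schwinger functions in four dimensions from three
classical facts**: the spectral condition (S–W Thm. 3-2 (b)), the Fourier–Laplace representation
of cone-supported distributions (Hörmander Thm. 7.4.2) and the Bargmann–Hall–Wightman theorem
(S–W Thm. 2-11). [folklore] -/
theorem IsWickRotationOf.schwinger_symmetric_dim4_of_three_facts {κ : Type*}
    (hb : ∀ W : WightmanData 3 κ, IsWightmanQFT.hasSpectralCondition_family (W := W))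
    (hL : ∀ n : ℕ, Literature.Analysis.Distribution.fourierLaplace_coneSupport (Fin n × Fin (3 + 1)))
    (hB : ∀ m : ℕ, exists_extension_extendedForwardTube (d := 3) (n := m)) :
    IsWickRotationOf.schwinger_symmetric (d := 3) (κ := κ) :=
  IsWickRotationOf.schwinger_symmetric_of_four_facts hb hL hB
    IsWightmanQFT.extendedTube_continuation_perm_eq_dim4_holds

end Literature.MathematicalPhysics.QuantumLattice
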